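import Summits.AtomisticToContinuum.BoseEinsteinCondensation.Theses.BECInfraredBound
import Literature.MathematicalPhysics.QuantumManyBody.BoseGasCatStates
import Literature.MathematicalPhysics.QuantumManyBody.BoseGasProductOrbital
import HarnessLib

/-!
# Disproof of `BecUvTail` (stmt-AtomisticToContinuum-8823) — standing adversary, cycle 1

Crux (route `BECInfraredBound`, rank 3), verbatim restated as `becUvTail_iff` (`Iff.rfl`) through the
named objects `innerBox` (`Λ' = (εL, L−εL)³`), `innerMode` (`φ'_k = 1_{Λ'} L'^{-3/2} e^{2πik·x/L'}`,
`L' = (1−2ε)L`) and `uvTail K ρ ε N ψ = Σ'_{‖k‖∞ > K√ρ L} ⟨φ'_k, γ_ψ φ'_k⟩`: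
for every repulsive finite-range `v` there are `K > 0`, `θ < 1` such that for every window margin
`ε ∈ (0, 1/4)`, all small `ρ`, eventually in `N`, every `δ_N`-near-minimiser `Ψ` of the Dirichlet box
`Λ_{L_N}`, `L_N = (N/ρ)^{1/3}`, has `uvTail K ρ ε N Ψ ≤ θN`.

## VERDICT (cycle 1, 2026-08-17): RESISTS — no counterexample exists; the crux is provable now.

WHY IT RESISTS (paper proof, constants not optimised). Fix a particle, a coordinate `j`, and freeze
all other variables; `g :=` the restriction of `Ψ` to the window `(εL, L−εL)` in `x_j` is `C¹` UP TO the
window's boundary (it does not vanish there — the "sharp window" worry of the kill criteria — and this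
is harmless).  One integration by parts WITH boundary term (`e^{-2πik} = 1`) gives for the window
Fourier coefficients `c_k = ⟨e_k, g⟩`, `p = 2πk/L'`:  `c_k = i(g(b)−g(a))/(p√L') + ⟨e_k, g'⟩/(ip)`, so
with the 1-D trace inequality `|g(a)|², |g(b)|² ≤ ‖g‖²/L' + 2‖g‖‖g'‖` and Bessel for `g'`:
    `Σ_{|k|>R} |c_k|² ≤ (4‖g‖² + 8L'‖g‖‖g'‖)/(π²R) + L'²‖g'‖²/(2π²R²)`.
Integrate over the frozen variables (Parseval in the two transverse window coordinates — `{φ'_k}` is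
an ONB of `L²(Λ')` — and Bose symmetry: `N∫|g|² ≤ ∫_{Λ'}ρ_Ψ ≤ N`, `N∫|∂_j g|² = T_j`, `Σ_j T_j =
T := ∫|∇Ψ|²`, Cauchy–Schwarz on the cross term), and note that the sup-norm shell `‖k‖∞ > R` lies in
the union of the three coordinate tails `|k_j| > R`.  With `R = K√ρL`, `L' ≤ L`:
    `uvTail/N ≤ 12/(π²K√ρL) + (8√3/π²)·√(T/ρN)/K + (T/ρN)/(2π²K²)`.
For a near-minimiser `T ≤ 𝓔[Ψ] ≤ E₀ + δ ≤ C(v)ρN` eventually (Dyson's upper bound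
`eventually_groundStateEnergy_le_dyson`; `a(v) < ∞` is automatic for finite range, and if `a(v) = 0`
the free Dirichlet value `3π²ρ^{2/3}N^{1/3} = o(ρN)` does it), hence
    `uvTail/N ≤ o(1) + 8√(3C)/(π²K) + C/(2π²K²)`,   uniformly in `ε ∈ [0, 1/2)` and in `ρ`.
So `K := K(C(v)) ≍ √C` and `θ := 1/2` work; nothing about the sharp indicator, the value of `ε`, or the
smallness of `ρ` beyond `E₀ ≤ CρN` is used.  The line `Lines/birth.lean` (`stub_kineticBudget` +
`stub_uvTailOfKineticBudget`) is exactly this proof; both stubs are TRUE as stated.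

## Findings (index; everything below is sorry-free unless marked NEAR-MISS)

* §0 OBJECTS. `innerBox`, `innerMode`, `uvTail`, `becUvTail_iff : BecUvTail ↔ … (Iff.rfl)`.
* §1 THE WITNESS (`WParam`, `plateau`, `WParam.orbital`, `WParam.state`): for margin `τ`, window `ε`
  (ANY `0 ≤ ε < 1/2`), side `L`: the product state `u^{⊗N}`, `u = A·o·e^{2πi k⋆·x/L'}`, `o(x) =
  ∏ plateau((x_j−εL)/L')` a `ContDiffBump` plateau (`= 1` on `[τ,1−τ]`, supported in `(0,1)`),
  normalised (`lintegral_orbital_sq`), Dirichlet (`orbital_eq_zero`), with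
  `⟨φ'_{k⋆}, γ φ'_{k⋆}⟩ = N·P₁⁶/P₂³ ≥ N(1−2τ)⁶` (`occupation_state`, `pairing_sq`, `le_pairing_sq`;
  `P₁ = ∫plateau ≥ 1−2τ`, `P₂ = ∫plateau² ≤ 1`).  MAIN LOWER BOUND `exists_lt_uvTail`: for EVERY
  `K, θ < 1, 0 ≤ ε < 1/2, ρ > 0` and EVERY `N ≥ 1` some trial state has `θN < uvTail K ρ ε N Ψ`
  (take `k⋆ = (⌊K√ρL⌋+1, 0, 0)`, `τ = (1 − max θ ½)/24`).  MORAL: without an energy constraint the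
  tail is arbitrary — every ounce of the crux is in `𝓔[Ψ] ≤ E₀ + δ` with `E₀ < ⊤`.
* §2 LOAD-BEARING HYPOTHESES (each `H` dropped ⇒ FALSE; "any proof must use H"):
  - `becUvTail_false_without_nearMin : ¬ BecUvTailWithoutNearMin` — drop `𝓔[Ψ] ≤ E₀+δ` (free gas `v=0`).
  - `becUvTail_false_without_finiteRange : ¬ BecUvTailWithoutFiniteRange` — keep `Measurable v`, drop
    the range: `v ≡ ⊤` gives `interaction = ⊤` (`interaction_top`, `N ≥ 2`), `energy = ⊤` (`energy_top`),
    `E₀ = ⊤` (`groundStateEnergy_top`), so the near-minimiser hypothesis is idle.  What is REALLY used is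
    `E₀ < ⊤` eventually (equivalently here: `a(v) < ∞` + small `ρ`), not smoothness/finiteness of `v`.
  - `becUvTail_false_allDensities : ¬ BecUvTailAllDensities` — replace `∃ ρ₀ … ρ < ρ₀` by
    `∀ ρ > 0`: FALSE for the unit hard core `hardCore = ⊤·1_{[0,1]}` at `ρ = 1000` (pigeonhole
    `exists_dist_lt_one`: `N` points of `Λ_L` in `(⌊2L⌋₊+1)³ < N` cells of diameter `< 1` (`jammed`,
    `N ≥ 1000`) ⇒ `interaction = ⊤` on `Λ_L^N` ⇒ `energy = ⊤` for every trial state ⇒ `E₀ = ⊤`).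
    So "small `ρ`" is load-bearing ONLY through jamming (`E₀ = ⊤`); for finite `v` it is idle
    (the IBP bound is uniform in `ρ`).
* §3 NOT LOAD-BEARING (information for the prover; no Lean needed): the witness and the IBP proof are
  both uniform in `ε ∈ [0, 1/2)` — the crux's `0 < ε < 1/4` and the ε-dependence of `ρ₀` are idle
  (`ρ₀` may be chosen independent of `ε`); `0 < K` is idle (any `K` works in §1; the proof needs `K`
  large, not positive); the sharp indicator `1_{Λ'}` needs NO smoothing (boundary terms are controlled by
  the trace inequality) — contrary to the worry in the route's kill criteria.
* §4 TIGHTNESS OF THE LINE (NEAR-MISS B, in progress) `not_uvTailOfKineticBudget_uniformK`: in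
  `stub_uvTailOfKineticBudget` the threshold `K` must grow with the kinetic constant `C`:
  the §1 witness has `T/N = (2πm/L')² + 3κ_τ/(P₂L'²) → (2πK)²ρ/(1−2ε)²`, so for `C > (2πK/(1−2ε))²`
  it satisfies `T ≤ CρN` eventually while `uvTail > θN`: NO `K` serves all `C`; necessarily
  `K(C) ≥ (1−2ε)√C/2π`, matching the `√C/K` shape of the IBP bound.  (Quantifier order in the stub,
  `∀ C ∃ K`, is therefore essential and correct.)

Navigation for provers: the pairing algebra `conj_innerMode_mul_orbital` (phases cancel exactly on
`Λ'`; no oscillatory integral), `occupation_powFun'` (`⟨φ, γ_{u^{⊗N}} φ⟩ = N|⟨φ,u⟩|²`) and the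
`ProductOrbital` toolkit (`integral_coord_prod`, `integral_orb_sq`) are reusable for the Parseval /
Bessel step of `stub_uvTailOfKineticBudget`.
-/

noncomputable section

namespace Summit.AtomisticToContinuum.BoseEinsteinCondensation.Cruxes.BecUvTail.Disproof

open MeasureTheory Filter Set Metric
open scoped ENNReal NNReal ComplexConjugate
open Literature.MathematicalPhysics.QuantumManyBody.BoseGas
open Summit.AtomisticToContinuum.BoseEinsteinCondensation.Theses.BECInfraredBound

/-! ### The crux's objects, named -/

/-- The inner box `Λ' = (εL, L − εL)³`, exactly as written in the crux. -/
def innerBox (ε L : ℝ) : Set Space := {x : EuclideanSpace ℝ (Fin 3) | ∀ j, x j ∈ Set.Ioo (ε * L) (L - ε * L)}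

/-- The inner-box plane wave `φ'_k = 1_{Λ'} · L'^{-3/2} e^{2πi k·x/L'}`, `L' = (1−2ε)L`, exactly as
written in the crux. -/
def innerMode (ε L : ℝ) (k : Fin 3 → ℤ) : Space → ℂ :=
  (innerBox ε L).indicator fun x => ((Real.sqrt (((1 - 2 * ε) * L) ^ 3))⁻¹ : ℂ) *
    Complex.exp (Complex.I * ↑(2 * Real.pi / ((1 - 2 * ε) * L) * ∑ j, ((k j : ℝ)) * x j))

/-- The crux's summed ultraviolet tail `Σ_{‖k‖∞ > K√ρL} ⟨φ'_k, γ_Ψ φ'_k⟩` (sup norm; `tsum` in `ℝ≥0∞`). -/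
def uvTail (K ρ ε : ℝ) (N : ℕ) (ψ : Config N → ℂ) : ℝ≥0∞ :=
  ∑' k : {k : Fin 3 → ℤ // K * Real.sqrt ρ * sideLength ρ N < ‖(fun j => (k j : ℝ))‖},
    occupation N (innerMode ε (sideLength ρ N) k) ψ

/-- `BecUvTail` restated through `uvTail` — DEFINITIONALLY the crux (`Iff.rfl`). -/
theorem becUvTail_iff : BecUvTail ↔
    ∀ v : ℝ → ℝ≥0∞, IsRepulsiveFiniteRange v → ∃ K : ℝ, 0 < K ∧ ∃ θ : ℝ, θ < 1 ∧
      ∀ ε : ℝ, 0 < ε → ε < 1 / 4 → ∃ ρ₀ : ℝ, 0 < ρ₀ ∧ ∀ ρ : ℝ, 0 < ρ → ρ < ρ₀ →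
        ∀ᶠ N : ℕ in atTop, ∃ δ : ℝ≥0∞, 0 < δ ∧ ∀ Ψ : TrialState N (sideLength ρ N),
          energy v Ψ ≤ groundStateEnergy v N (sideLength ρ N) + δ →
            uvTail K ρ ε N Ψ.ψ ≤ ENNReal.ofReal (θ * N) :=
  Iff.rfl

/-! ### The plateau profile -/

/-- A smooth plateau profile on `(0,1)`: `= 1` on `[τ, 1−τ]`, supported in `(0,1)`, values in `[0,1]`. -/
def plateau (τ : ℝ) (hτ : 0 < τ ∧ τ < 1 / 2) : ContDiffBump (1 / 2 : ℝ) :=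
  ⟨1 / 2 - τ, 1 / 2, by linarith [hτ.2], by linarith [hτ.1]⟩

variable {τ : ℝ} (hτ : 0 < τ ∧ τ < 1 / 2)

theorem plateau_eq_one {t : ℝ} (ht : t ∈ Icc τ (1 - τ)) : plateau τ hτ t = 1 := by
  apply ContDiffBump.one_of_mem_closedBall
  rw [mem_closedBall, Real.dist_eq, abs_le]
  simp only [plateau]
  constructor <;> linarith [ht.1, ht.2]

theorem plateau_eq_zero {t : ℝ} (ht : t ∉ Ioo (0 : ℝ) 1) : plateau τ hτ t = 0 := by
  apply ContDiffBump.zero_of_le_dist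
  simp only [plateau, Real.dist_eq]
  rw [mem_Ioo, not_and_or, not_lt, not_lt] at ht
  rcases ht with h | h
  · rw [abs_of_nonpos (by linarith)]; linarith
  · rw [abs_of_nonneg (by linarith)]; linarith

theorem plateau_nonneg (t : ℝ) : 0 ≤ plateau τ hτ t := (plateau τ hτ).nonneg
theorem plateau_le_one (t : ℝ) : plateau τ hτ t ≤ 1 := (plateau τ hτ).le_one
theorem plateau_contDiff : ContDiff ℝ 1 (plateau τ hτ) := (plateau τ hτ).contDiff
theorem plateau_continuous : Continuous (plateau τ hτ) := (plateau τ hτ).continuous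

theorem plateau_integrable : Integrable (plateau τ hτ) :=
  (plateau τ hτ).continuous.integrable_of_hasCompactSupport (plateau τ hτ).hasCompactSupport

theorem plateau_sq_integrable : Integrable fun t => plateau τ hτ t ^ 2 := by
  refine (plateau_integrable hτ).mono' ((plateau τ hτ).continuous.pow 2).aestronglyMeasurable
    (Filter.Eventually.of_forall fun t => ?_)
  rw [Real.norm_eq_abs, abs_of_nonneg (sq_nonneg _), sq]
  exact mul_le_of_le_one_left (plateau_nonneg hτ t) (plateau_le_one hτ t)

/-- `∫ plateau ≥ 1 − 2τ`. -/
theorem le_integral_plateau : 1 - 2 * τ ≤ ∫ t, plateau τ hτ t := by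
  have h1 : ∫ t, (Icc τ (1 - τ)).indicator (fun _ => (1 : ℝ)) t = 1 - 2 * τ := by
    rw [integral_indicator measurableSet_Icc, setIntegral_const, smul_eq_mul, mul_one,
      Real.volume_real_Icc_of_le (by linarith [hτ.2])]
    ring
  refine le_of_eq_of_le h1.symm (integral_mono ?_ (plateau_integrable hτ) fun t => ?_)
  · exact (integrable_indicator_iff measurableSet_Icc).2 (integrableOn_const (by simp))
  · by_cases ht : t ∈ Icc τ (1 - τ)
    · rw [indicator_of_mem ht, plateau_eq_one hτ ht]
    · rw [indicator_of_notMem ht]; exact plateau_nonneg hτ t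

/-- `∫ plateau² ≤ 1`. -/
theorem integral_plateau_sq_le : ∫ t, plateau τ hτ t ^ 2 ≤ 1 := by
  have h1 : ∫ t, (Ioo (0 : ℝ) 1).indicator (fun _ => (1 : ℝ)) t = 1 := by
    rw [integral_indicator measurableSet_Ioo, setIntegral_const, smul_eq_mul, mul_one,
      Real.volume_real_Ioo_of_le zero_le_one]
    ring
  refine le_of_le_of_eq (integral_mono (plateau_sq_integrable hτ) ?_ fun t => ?_) h1
  · exact (integrable_indicator_iff measurableSet_Ioo).2 (integrableOn_const (by simp))
  · by_cases ht : t ∈ Ioo (0 : ℝ) 1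
    · rw [indicator_of_mem ht]
      have := plateau_le_one hτ t
      have := plateau_nonneg hτ t
      nlinarith
    · rw [indicator_of_notMem ht, plateau_eq_zero hτ ht]; norm_num

/-- `1 − 2τ ≤ ∫ plateau²` (in particular it is positive). -/
theorem le_integral_plateau_sq : 1 - 2 * τ ≤ ∫ t, plateau τ hτ t ^ 2 := by
  have h1 : ∫ t, (Icc τ (1 - τ)).indicator (fun _ => (1 : ℝ)) t = 1 - 2 * τ := by
    rw [integral_indicator measurableSet_Icc, setIntegral_const, smul_eq_mul, mul_one,
      Real.volume_real_Icc_of_le (by linarith [hτ.2])]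
    ring
  refine le_of_eq_of_le h1.symm (integral_mono ?_ (plateau_sq_integrable hτ) fun t => ?_)
  · exact (integrable_indicator_iff measurableSet_Icc).2 (integrableOn_const (by simp))
  · by_cases ht : t ∈ Icc τ (1 - τ)
    · rw [indicator_of_mem ht, plateau_eq_one hτ ht]; norm_num
    · rw [indicator_of_notMem ht]; positivity

/-! ### The phase of the inner-box modes -/

/-- The plane-wave phase `e^{2πi k·x/L'}` of the crux's inner-box mode (verbatim sub-term). -/
def phase (ε L : ℝ) (k : Fin 3 → ℤ) (x : Space) : ℂ :=
  Complex.exp (Complex.I * ↑(2 * Real.pi / ((1 - 2 * ε) * L) * ∑ j, ((k j : ℝ)) * x j))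

theorem innerMode_eq (ε L : ℝ) (k : Fin 3 → ℤ) :
    innerMode ε L k = (innerBox ε L).indicator fun x =>
      ((Real.sqrt (((1 - 2 * ε) * L) ^ 3))⁻¹ : ℂ) * phase ε L k x := rfl

theorem norm_phase (ε L : ℝ) (k : Fin 3 → ℤ) (x : Space) : ‖phase ε L k x‖ = 1 :=
  Complex.norm_exp_I_mul_ofReal _

theorem nnnorm_phase (ε L : ℝ) (k : Fin 3 → ℤ) (x : Space) : ‖phase ε L k x‖₊ = 1 := by
  rw [← NNReal.coe_eq_one, coe_nnnorm, norm_phase]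

theorem conj_phase_mul_phase (ε L : ℝ) (k : Fin 3 → ℤ) (x : Space) :
    conj (phase ε L k x) * phase ε L k x = 1 := by
  rw [RCLike.conj_mul, norm_phase]
  simp

theorem contDiff_phase (ε L : ℝ) (k : Fin 3 → ℤ) {n : ℕ∞} : ContDiff ℝ n (phase ε L k) := by
  unfold phase
  refine ContDiff.cexp (contDiff_const.mul (Complex.ofRealCLM.contDiff.comp
    (contDiff_const.mul (ContDiff.sum fun j _ => contDiff_const.mul ?_))))
  exact (EuclideanSpace.proj j : Space →L[ℝ] ℝ).contDiff

/-! ### The witness family: parameters -/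

/-- Parameters of the witness: plateau margin `τ`, window margin `ε`, box side `L`. -/
structure WParam where
  /-- plateau margin -/
  τ : ℝ
  /-- window margin (the crux's `ε`; `ε = 0` allowed) -/
  ε : ℝ
  /-- side of the box -/
  L : ℝ
  hτ : 0 < τ ∧ τ < 1 / 2
  hε : 0 ≤ ε ∧ ε < 1 / 2
  hL : 0 < L

namespace WParam

variable (w : WParam)

/-- The inner side length `L' = (1 − 2ε)L`. -/
def ell : ℝ := (1 - 2 * w.ε) * w.L

theorem ell_pos : 0 < w.ell := mul_pos (by linarith [w.hε.2]) w.hL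

/-- `P₁ = ∫ plateau`. -/
def P₁ : ℝ := ∫ t, plateau w.τ w.hτ t

/-- `P₂ = ∫ plateau²`. -/
def P₂ : ℝ := ∫ t, plateau w.τ w.hτ t ^ 2

theorem le_P₁ : 1 - 2 * w.τ ≤ w.P₁ := le_integral_plateau w.hτ
theorem P₁_pos : 0 < w.P₁ := lt_of_lt_of_le (by linarith [w.hτ.2]) w.le_P₁
theorem P₂_pos : 0 < w.P₂ := lt_of_lt_of_le (by linarith [w.hτ.2]) (le_integral_plateau_sq w.hτ)
theorem P₂_le_one : w.P₂ ≤ 1 := integral_plateau_sq_le w.hτ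

/-- The rescaled one-dimensional profile `g(t) = plateau((t − εL)/L')`. -/
def prof (t : ℝ) : ℝ := plateau w.τ w.hτ ((t - w.ε * w.L) / w.ell)

theorem contDiff_prof {n : ℕ∞} : ContDiff ℝ n w.prof :=
  (plateau w.τ w.hτ).contDiff.comp ((contDiff_id.sub contDiff_const).div_const _)

theorem prof_eq_zero {t : ℝ} (ht : t ∉ Ioo (w.ε * w.L) (w.L - w.ε * w.L)) : w.prof t = 0 := by
  apply plateau_eq_zero
  intro h
  apply ht
  rw [mem_Ioo] at h ⊢
  have hl := w.ell_pos
  obtain ⟨h1, h2⟩ := h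
  rw [lt_div_iff₀ hl] at h1
  rw [div_lt_iff₀ hl] at h2
  unfold ell at h1 h2
  constructor <;> nlinarith

theorem integral_prof : ∫ t, w.prof t = w.ell * w.P₁ := by
  have h1 : ∫ t, w.prof t = ∫ s, plateau w.τ w.hτ (s / w.ell) :=
    integral_sub_right_eq_self (μ := volume) (fun s => plateau w.τ w.hτ (s / w.ell)) (w.ε * w.L)
  have h2 : ∫ s, plateau w.τ w.hτ (s / w.ell) = |w.ell| • ∫ s, plateau w.τ w.hτ s :=
    Measure.integral_comp_div _ _
  rw [h1, h2, abs_of_pos w.ell_pos, smul_eq_mul]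
  rfl

theorem integral_prof_sq : ∫ t, w.prof t ^ 2 = w.ell * w.P₂ := by
  have h1 : ∫ t, w.prof t ^ 2 = ∫ s, plateau w.τ w.hτ (s / w.ell) ^ 2 :=
    integral_sub_right_eq_self (μ := volume) (fun s => plateau w.τ w.hτ (s / w.ell) ^ 2) (w.ε * w.L)
  have h2 : ∫ s, plateau w.τ w.hτ (s / w.ell) ^ 2 = |w.ell| • ∫ s, plateau w.τ w.hτ s ^ 2 :=
    Measure.integral_comp_div (fun s => plateau w.τ w.hτ s ^ 2) _
  rw [h1, h2, abs_of_pos w.ell_pos, smul_eq_mul]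
  rfl

theorem integrable_prof_sq : Integrable fun t => w.prof t ^ 2 := by
  have h : Integrable fun s => plateau w.τ w.hτ (s / w.ell) ^ 2 :=
    (plateau_sq_integrable w.hτ).comp_div w.ell_pos.ne'
  exact h.comp_sub_right (w.ε * w.L)

theorem integrable_prof : Integrable w.prof := by
  have h : Integrable fun s => plateau w.τ w.hτ (s / w.ell) :=
    (plateau_integrable w.hτ).comp_div w.ell_pos.ne'
  exact h.comp_sub_right (w.ε * w.L)

/-- The envelope `o(x) = g(x₁) g(x₂) g(x₃)`. -/
def env (x : Space) : ℝ := w.prof (x 0) * w.prof (x 1) * w.prof (x 2)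

theorem env_def (x : Space) : w.env x = w.prof (x 0) * w.prof (x 1) * w.prof (x 2) := rfl

theorem contDiff_env : ContDiff ℝ 1 w.env :=
  ((w.contDiff_prof.comp (EuclideanSpace.proj (0 : Fin 3) : Space →L[ℝ] ℝ).contDiff).mul
    (w.contDiff_prof.comp (EuclideanSpace.proj (1 : Fin 3) : Space →L[ℝ] ℝ).contDiff)).mul
    (w.contDiff_prof.comp (EuclideanSpace.proj (2 : Fin 3) : Space →L[ℝ] ℝ).contDiff)

theorem env_eq_zero {x : Space} (hx : x ∉ innerBox w.ε w.L) : w.env x = 0 := by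
  simp only [innerBox, Set.mem_setOf_eq, not_forall] at hx
  obtain ⟨j, hj⟩ := hx
  have h : w.prof (x j) = 0 := w.prof_eq_zero hj
  unfold env
  fin_cases j
  · simp only [Fin.zero_eta] at h; rw [h]; ring
  · simp only [Fin.mk_one] at h; rw [h]; ring
  · rw [show (2 : Fin 3) = ⟨2, by norm_num⟩ from rfl, h]; ring

theorem innerBox_subset_box : innerBox w.ε w.L ⊆ box w.L := by
  intro x hx k
  have h : x k ∈ Ioo (w.ε * w.L) (w.L - w.ε * w.L) := hx k
  rw [mem_Ioo] at h ⊢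
  have : 0 ≤ w.ε * w.L := mul_nonneg w.hε.1 w.hL.le
  constructor <;> linarith [h.1, h.2]

theorem integral_env : ∫ x, w.env x = (w.ell * w.P₁) ^ 3 := by
  unfold env
  rw [ProductOrbital.integral_coord_prod w.prof w.prof w.prof, w.integral_prof]
  ring

theorem integral_env_sq : ∫ x, w.env x ^ 2 = (w.ell * w.P₂) ^ 3 :=
  ProductOrbital.integral_orb_sq w.integral_prof_sq w.env_def

theorem integrable_env_sq : Integrable fun x => w.env x ^ 2 :=
  ProductOrbital.integrable_orb_sq w.integrable_prof_sq w.env_def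

theorem integrable_env : Integrable w.env := by
  unfold env
  exact ProductOrbital.integrable_coord_prod w.integrable_prof w.integrable_prof w.integrable_prof

/-- The amplitude `A = (L' P₂)^{-3/2}`. -/
def amp : ℝ := (Real.sqrt ((w.ell * w.P₂) ^ 3))⁻¹

theorem amp_sq : w.amp ^ 2 = ((w.ell * w.P₂) ^ 3)⁻¹ := by
  rw [amp, inv_pow, Real.sq_sqrt (pow_pos (mul_pos w.ell_pos w.P₂_pos) 3).le]

/-- The one-body orbital `u_k = A · o · e^{2πi k·x/L'}`. -/
def orbital (k : Fin 3 → ℤ) (x : Space) : ℂ := ((w.amp * w.env x : ℝ) : ℂ) * phase w.ε w.L k x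

theorem contDiff_orbital (k : Fin 3 → ℤ) : ContDiff ℝ 1 (w.orbital k) :=
  (Complex.ofRealCLM.contDiff.comp (contDiff_const.mul w.contDiff_env)).mul (contDiff_phase _ _ k)

theorem contDiff_oneFun_orbital (k : Fin 3 → ℤ) : ContDiff ℝ 1 (oneFun (w.orbital k)) :=
  (w.contDiff_orbital k).comp (contDiff_apply ℝ Space 0)

theorem orbital_eq_zero (k : Fin 3 → ℤ) {x : Space} (hx : x ∉ box w.L) : w.orbital k x = 0 := by
  have h : w.env x = 0 := w.env_eq_zero fun h => hx (w.innerBox_subset_box h)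
  rw [orbital, h, mul_zero, Complex.ofReal_zero, zero_mul]

theorem ennnorm_orbital_sq (k : Fin 3 → ℤ) (x : Space) :
    ((‖w.orbital k x‖₊ : ℝ≥0∞)) ^ 2 = ENNReal.ofReal ((w.amp * w.env x) ^ 2) := by
  rw [orbital, nnnorm_mul, ENNReal.coe_mul, mul_pow, ennnorm_real_sq, nnnorm_phase, ENNReal.coe_one,
    one_pow, mul_one]

theorem lintegral_orbital_sq (k : Fin 3 → ℤ) : ∫⁻ x, (‖w.orbital k x‖₊ : ℝ≥0∞) ^ 2 = 1 := by
  simp_rw [ennnorm_orbital_sq]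
  rw [← ofReal_integral_eq_lintegral_ofReal ((w.integrable_env_sq.const_mul (w.amp ^ 2)).congr
    (ae_of_all _ fun x => by ring)) (ae_of_all _ fun x => sq_nonneg _)]
  have h : ∫ x, (w.amp * w.env x) ^ 2 = w.amp ^ 2 * ∫ x, w.env x ^ 2 := by
    rw [← integral_const_mul]
    exact integral_congr_ae (ae_of_all _ fun x => by ring)
  rw [h, w.integral_env_sq, amp_sq, inv_mul_cancel₀ (pow_pos (mul_pos w.ell_pos w.P₂_pos) 3).ne',
    ENNReal.ofReal_one]

theorem lintegral_oneFun_orbital_sq (k : Fin 3 → ℤ) :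
    ∫⁻ Y, (‖oneFun (w.orbital k) Y‖₊ : ℝ≥0∞) ^ 2 = 1 :=
  (lintegral_funUnique_comp fun x => (‖w.orbital k x‖₊ : ℝ≥0∞) ^ 2).trans (w.lintegral_orbital_sq k)

end WParam

/-! ### Occupations of product states -/

/-- Occupation of a mode in a product state: `⟨φ, γ_{u^{⊗(n+1)}} φ⟩ = (n+1)|⟨φ,u⟩|²`
(re-proved here; cf. `FreeHaarBand.occupation_powFun`). [folklore] -/
theorem occupation_powFun' {u : Space → ℂ} (hu : ContDiff ℝ 1 (oneFun u))
    (h1 : ∫⁻ Y, (‖oneFun u Y‖₊ : ℝ≥0∞) ^ 2 = 1) (φ : Space → ℂ) (n : ℕ) :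
    occupation (n + 1) φ (powFun u (n + 1)) =
      (n + 1 : ℝ≥0∞) * (‖∫ x, conj (φ x) * u x‖₊ : ℝ≥0∞) ^ 2 := by
  unfold occupation
  have hY : ∀ Y : Config n, ∫ x, conj (φ x) * powFun u (n + 1) (Matrix.vecCons x Y) =
      (∫ x, conj (φ x) * u x) * powFun u n Y := by
    intro Y
    simp_rw [powFun_vecCons]
    rw [← integral_mul_const]
    congr 1
    funext x
    ring
  simp_rw [hY, nnnorm_mul, ENNReal.coe_mul, mul_pow]
  rw [lintegral_const_mul' _ _ (ENNReal.pow_ne_top ENNReal.coe_ne_top), lintegral_powFun_sq hu h1 n,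
    mul_one]

namespace WParam

variable (w : WParam)

/-- Pointwise pairing: `conj(φ'_k) · u_k = L'^{-3/2} A o` (the phases cancel; both vanish off `Λ'`). -/
theorem conj_innerMode_mul_orbital (k : Fin 3 → ℤ) (x : Space) :
    conj (innerMode w.ε w.L k x) * w.orbital k x =
      (((Real.sqrt (w.ell ^ 3))⁻¹ * (w.amp * w.env x) : ℝ) : ℂ) := by
  unfold ell
  by_cases hx : x ∈ innerBox w.ε w.L
  · rw [innerMode_eq, indicator_of_mem hx, orbital, map_mul, map_inv₀, Complex.conj_ofReal]
    have h := conj_phase_mul_phase w.ε w.L k x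
    push_cast
    linear_combination ((↑(Real.sqrt (((1 - 2 * w.ε) * w.L) ^ 3)) : ℂ)⁻¹ *
      ((↑w.amp : ℂ) * (↑(w.env x) : ℂ))) * h
  · rw [innerMode_eq, indicator_of_notMem hx, map_zero, zero_mul, w.env_eq_zero hx, mul_zero,
      mul_zero, Complex.ofReal_zero]

theorem integral_conj_innerMode_mul_orbital (k : Fin 3 → ℤ) :
    ∫ x, conj (innerMode w.ε w.L k x) * w.orbital k x =
      (((Real.sqrt (w.ell ^ 3))⁻¹ * w.amp * (w.ell * w.P₁) ^ 3 : ℝ) : ℂ) := by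
  simp_rw [conj_innerMode_mul_orbital]
  rw [integral_complex_ofReal, integral_const_mul, integral_const_mul, integral_env]
  push_cast
  ring

/-- The squared pairing `|⟨φ'_k, u_k⟩|² = P₁⁶ / P₂³`. -/
theorem pairing_sq :
    ((Real.sqrt (w.ell ^ 3))⁻¹ * w.amp * (w.ell * w.P₁) ^ 3) ^ 2 = w.P₁ ^ 6 / w.P₂ ^ 3 := by
  have hl := w.ell_pos
  have hP₂ := w.P₂_pos
  rw [mul_pow, mul_pow, amp_sq, inv_pow, Real.sq_sqrt (pow_pos hl 3).le]
  field_simp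

theorem le_pairing_sq :
    (1 - 2 * w.τ) ^ 6 ≤ ((Real.sqrt (w.ell ^ 3))⁻¹ * w.amp * (w.ell * w.P₁) ^ 3) ^ 2 := by
  rw [pairing_sq, le_div_iff₀ (pow_pos w.P₂_pos 3)]
  have h0 : 0 ≤ 1 - 2 * w.τ := by linarith [w.hτ.2]
  have h1 : (1 - 2 * w.τ) ^ 6 ≤ w.P₁ ^ 6 := pow_le_pow_left₀ h0 w.le_P₁ 6
  have h2 : w.P₂ ^ 3 ≤ 1 := pow_le_one₀ w.P₂_pos.le w.P₂_le_one
  have h3 : 0 ≤ (1 - 2 * w.τ) ^ 6 := pow_nonneg h0 6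
  nlinarith

/-- **The witness trial state** `u_k^{⊗N}` (all particles in the modulated plateau orbital). -/
def state (k : Fin 3 → ℤ) (N : ℕ) : TrialState N w.L where
  ψ := powFun (w.orbital k) N
  contDiff := contDiff_powFun (w.contDiff_oneFun_orbital k) N
  eq_zero X hX := by
    have : ∃ i, X i ∉ box w.L := by simpa [boxN] using hX
    obtain ⟨i, hi⟩ := this
    exact powFun_eq_zero_of_exists _ ⟨i, w.orbital_eq_zero k hi⟩
  symm σ X := powFun_comp_perm _ σ X
  norm_eq := lintegral_powFun_sq (w.contDiff_oneFun_orbital k) (w.lintegral_oneFun_orbital_sq k) N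

@[simp] theorem state_ψ (k : Fin 3 → ℤ) (N : ℕ) : (w.state k N).ψ = powFun (w.orbital k) N := rfl

/-- Occupation of the matching inner-box mode in the witness: `(n+1) · P₁⁶/P₂³`. -/
theorem occupation_state (k : Fin 3 → ℤ) (n : ℕ) :
    occupation (n + 1) (innerMode w.ε w.L k) (w.state k (n + 1)).ψ =
      (n + 1 : ℝ≥0∞) *
        ENNReal.ofReal (((Real.sqrt (w.ell ^ 3))⁻¹ * w.amp * (w.ell * w.P₁) ^ 3) ^ 2) := by
  rw [state_ψ, occupation_powFun' (w.contDiff_oneFun_orbital k) (w.lintegral_oneFun_orbital_sq k),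
    integral_conj_innerMode_mul_orbital, ennnorm_real_sq]

theorem ofReal_lt_occupation_state (k : Fin 3 → ℤ) (n : ℕ) {θ : ℝ} (hθ : θ < (1 - 2 * w.τ) ^ 6) :
    ENNReal.ofReal (θ * (n + 1)) <
      occupation (n + 1) (innerMode w.ε w.L k) (w.state k (n + 1)).ψ := by
  rw [occupation_state]
  have hr := w.le_pairing_sq
  have hn : (0 : ℝ) < n + 1 := by positivity
  have hlt := mul_lt_mul_of_pos_left (hθ.trans_le hr) hn
  have hq : 0 < (n + 1 : ℝ) * ((Real.sqrt (w.ell ^ 3))⁻¹ * w.amp * (w.ell * w.P₁) ^ 3) ^ 2 :=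
    mul_pos hn ((pow_pos (by linarith [w.hτ.2]) 6).trans_le hr)
  have hc : (n + 1 : ℝ≥0∞) = ENNReal.ofReal (n + 1) := by
    rw [ENNReal.ofReal_add n.cast_nonneg zero_le_one, ENNReal.ofReal_natCast, ENNReal.ofReal_one]
  rw [hc, ← ENNReal.ofReal_mul hn.le, ENNReal.ofReal_lt_ofReal_iff hq]
  linarith

end WParam

/-! ### The high mode and the main lower bound -/

/-- The high mode `k⋆ = (m, 0, 0)`. -/
def kStar (m : ℕ) : Fin 3 → ℤ := fun j => if j = 0 then (m : ℤ) else 0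

theorem le_norm_kStar (m : ℕ) : (m : ℝ) ≤ ‖fun j => ((kStar m j : ℤ) : ℝ)‖ := by
  have h0 : (fun j => ((kStar m j : ℤ) : ℝ)) 0 = m := by simp [kStar]
  calc (m : ℝ) = ‖(fun j => ((kStar m j : ℤ) : ℝ)) 0‖ := by rw [h0, Real.norm_natCast]
    _ ≤ _ := norm_le_pi_norm (fun j => ((kStar m j : ℤ) : ℝ)) (0 : Fin 3)

/-- **Main lower bound.** For every threshold `K`, every `θ < 1`, every margin `0 ≤ ε < 1/2`, every
density `ρ > 0` and EVERY particle number `N ≥ 1` there is a Dirichlet trial state of `Λ_{L_N}` whose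
crux tail `uvTail K ρ ε N` exceeds `θN`: the product state `u^{⊗N}` of the plateau orbital modulated
by the inner-box plane wave of index `(⌊K√ρ L⌋+1, 0, 0)`. (No energy constraint is imposed.) -/
theorem exists_lt_uvTail (K θ ε ρ : ℝ) (hθ : θ < 1) (hε : 0 ≤ ε ∧ ε < 1 / 2) (hρ : 0 < ρ) (n : ℕ) :
    ∃ Ψ : TrialState (n + 1) (sideLength ρ (n + 1)),
      ENNReal.ofReal (θ * (n + 1)) < uvTail K ρ ε (n + 1) Ψ.ψ := by
  set θ' := max θ (1 / 2) with hθ'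
  have hθ'1 : θ' < 1 := max_lt hθ (by norm_num)
  have hθ'0 : 1 / 2 ≤ θ' := le_max_right _ _
  set τ := (1 - θ') / 24 with hτ_def
  have hτ : 0 < τ ∧ τ < 1 / 2 := ⟨by linarith, by linarith⟩
  have hL : 0 < sideLength ρ (n + 1) := sideLength_pos_of_pos hρ (Nat.succ_pos n)
  let w : WParam := ⟨τ, ε, sideLength ρ (n + 1), hτ, hε, hL⟩
  set m := ⌊K * Real.sqrt ρ * sideLength ρ (n + 1)⌋₊ + 1 with hm_def
  have hm : K * Real.sqrt ρ * sideLength ρ (n + 1) < m := by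
    rw [hm_def]; push_cast; exact Nat.lt_floor_add_one _
  have hθτ : θ < (1 - 2 * w.τ) ^ 6 := by
    have hb : 1 - 12 * τ ≤ (1 - 2 * τ) ^ 6 := by
      have := one_add_mul_le_pow (show (-2 : ℝ) ≤ -2 * τ by linarith) 6
      rw [show (1 : ℝ) + -2 * τ = 1 - 2 * τ by ring] at this
      push_cast at this
      linarith
    show θ < (1 - 2 * τ) ^ 6
    calc θ ≤ θ' := le_max_left _ _
      _ < 1 - 12 * τ := by rw [hτ_def]; linarith
      _ ≤ _ := hb
  refine ⟨w.state (kStar m) (n + 1), ?_⟩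
  calc ENNReal.ofReal (θ * (n + 1))
      < occupation (n + 1) (innerMode ε (sideLength ρ (n + 1)) (kStar m))
          (w.state (kStar m) (n + 1)).ψ :=
        w.ofReal_lt_occupation_state (kStar m) n hθτ
    _ ≤ uvTail K ρ ε (n + 1) (w.state (kStar m) (n + 1)).ψ :=
        ENNReal.le_tsum (f := fun k : {k : Fin 3 → ℤ //
            K * Real.sqrt ρ * sideLength ρ (n + 1) < ‖(fun j => (k j : ℝ))‖} =>
          occupation (n + 1) (innerMode ε (sideLength ρ (n + 1)) k) (w.state (kStar m) (n + 1)).ψ)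
          ⟨kStar m, hm.trans_le (le_norm_kStar m)⟩

/-! ### (a) Load-bearing hypotheses -/

/-- `BecUvTail` with the NEAR-MINIMISER hypothesis `𝓔[Ψ] ≤ E₀ + δ` dropped (its `∃ δ > 0` prefix is then
idle and is dropped with it); everything else verbatim. -/
def BecUvTailWithoutNearMin : Prop :=
  ∀ v : ℝ → ℝ≥0∞, IsRepulsiveFiniteRange v → ∃ K : ℝ, 0 < K ∧ ∃ θ : ℝ, θ < 1 ∧
    ∀ ε : ℝ, 0 < ε → ε < 1 / 4 → ∃ ρ₀ : ℝ, 0 < ρ₀ ∧ ∀ ρ : ℝ, 0 < ρ → ρ < ρ₀ →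
      ∀ᶠ N : ℕ in atTop, ∀ Ψ : TrialState N (sideLength ρ N),
        uvTail K ρ ε N Ψ.ψ ≤ ENNReal.ofReal (θ * N)

/-- **Any proof of `BecUvTail` must use the near-minimiser hypothesis**: without it the statement is
false already for the free gas `v = 0` (witness: `exists_lt_uvTail`). -/
theorem becUvTail_false_without_nearMin : ¬ BecUvTailWithoutNearMin := by
  intro h
  obtain ⟨K, -, θ, hθ, h⟩ := h 0 ⟨measurable_const, 0, fun _ _ => rfl⟩
  obtain ⟨ρ₀, hρ₀, h⟩ := h (1 / 8) (by norm_num) (by norm_num)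
  obtain ⟨N₀, hN₀⟩ := eventually_atTop.1 (h (ρ₀ / 2) (by positivity) (by linarith))
  obtain ⟨Ψ, hΨ⟩ :=
    exists_lt_uvTail K θ (1 / 8) (ρ₀ / 2) hθ ⟨by norm_num, by norm_num⟩ (by positivity) N₀
  have h1 := hN₀ (N₀ + 1) (Nat.le_succ _) Ψ
  push_cast at h1
  exact absurd h1 (not_le.2 hΨ)

/-- With `v ≡ ⊤` (measurable, but NOT of finite range) every pair interacts infinitely: `𝓥 ≡ ⊤` (`N ≥ 2`). -/
theorem interaction_top {N : ℕ} (hN : 2 ≤ N) (X : Config N) : interaction (⊤ : ℝ → ℝ≥0∞) X = ⊤ := by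
  unfold interaction
  set i0 : Fin N := ⟨0, by omega⟩ with hi0
  set i1 : Fin N := ⟨1, by omega⟩ with hi1
  have h01 : i0 < i1 := Fin.mk_lt_mk.2 zero_lt_one
  refine eq_top_iff.2 ?_
  calc (⊤ : ℝ≥0∞) = (⊤ : ℝ → ℝ≥0∞) (dist (X i0) (X i1)) := rfl
    _ ≤ ∑ j : Fin N with i0 < j, (⊤ : ℝ → ℝ≥0∞) (dist (X i0) (X j)) :=
        Finset.single_le_sum (f := fun j => (⊤ : ℝ → ℝ≥0∞) (dist (X i0) (X j))) (fun _ _ => zero_le)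
          (Finset.mem_filter.2 ⟨Finset.mem_univ _, h01⟩)
    _ ≤ ∑ i : Fin N, ∑ j : Fin N with i < j, (⊤ : ℝ → ℝ≥0∞) (dist (X i) (X j)) :=
        Finset.single_le_sum (f := fun i => ∑ j : Fin N with i < j, (⊤ : ℝ → ℝ≥0∞) (dist (X i) (X j)))
          (fun _ _ => zero_le) (Finset.mem_univ i0)

/-- Hence every Dirichlet trial state has infinite energy for `v ≡ ⊤`, `N ≥ 2`. -/
theorem energy_top {N : ℕ} {L : ℝ} (hN : 2 ≤ N) (Ψ : TrialState N L) :
    energy (⊤ : ℝ → ℝ≥0∞) Ψ = ⊤ := by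
  unfold energy
  simp only [interaction_top hN]
  refine eq_top_iff.2 ?_
  have hmeas : Measurable fun X => (‖Ψ.ψ X‖₊ : ℝ≥0∞) ^ 2 :=
    (Ψ.contDiff.continuous.measurable.nnnorm.coe_nnreal_ennreal).pow_const 2
  calc (⊤ : ℝ≥0∞) = ⊤ * ∫⁻ X, (‖Ψ.ψ X‖₊ : ℝ≥0∞) ^ 2 := by rw [Ψ.norm_eq, mul_one]
    _ = ∫⁻ X, ⊤ * (‖Ψ.ψ X‖₊ : ℝ≥0∞) ^ 2 := (lintegral_const_mul ⊤ hmeas).symm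
    _ ≤ ∫⁻ X, kineticDensity Ψ.ψ X + ⊤ * (‖Ψ.ψ X‖₊ : ℝ≥0∞) ^ 2 := lintegral_mono fun X => le_add_self

/-- … and the ground-state energy is `⊤`, so the near-minimiser hypothesis `𝓔[Ψ] ≤ E₀ + δ` is idle. -/
theorem groundStateEnergy_top {N : ℕ} (hN : 2 ≤ N) (L : ℝ) :
    groundStateEnergy (⊤ : ℝ → ℝ≥0∞) N L = ⊤ := by
  unfold groundStateEnergy
  exact iInf_eq_top.2 fun Ψ => energy_top hN Ψ

/-- `BecUvTail` with FINITE RANGE dropped from `IsRepulsiveFiniteRange v` (keeping measurability; hard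
cores stay allowed, as in the crux); everything else verbatim. -/
def BecUvTailWithoutFiniteRange : Prop :=
  ∀ v : ℝ → ℝ≥0∞, Measurable v → ∃ K : ℝ, 0 < K ∧ ∃ θ : ℝ, θ < 1 ∧
    ∀ ε : ℝ, 0 < ε → ε < 1 / 4 → ∃ ρ₀ : ℝ, 0 < ρ₀ ∧ ∀ ρ : ℝ, 0 < ρ → ρ < ρ₀ →
      ∀ᶠ N : ℕ in atTop, ∃ δ : ℝ≥0∞, 0 < δ ∧ ∀ Ψ : TrialState N (sideLength ρ N),
        energy v Ψ ≤ groundStateEnergy v N (sideLength ρ N) + δ →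
          uvTail K ρ ε N Ψ.ψ ≤ ENNReal.ofReal (θ * N)

/-- **Any proof of `BecUvTail` must use the finite range of `v`** (really: `E₀ < ⊤`): for the
everywhere-hard-core `v ≡ ⊤` the ground-state energy is `⊤`, the near-minimiser hypothesis is idle,
and the free witness applies. -/
theorem becUvTail_false_without_finiteRange : ¬ BecUvTailWithoutFiniteRange := by
  intro h
  obtain ⟨K, -, θ, hθ, h⟩ := h ⊤ measurable_const
  obtain ⟨ρ₀, hρ₀, h⟩ := h (1 / 8) (by norm_num) (by norm_num)
  obtain ⟨N₀, hN₀⟩ := eventually_atTop.1 (h (ρ₀ / 2) (by positivity) (by linarith))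
  obtain ⟨δ, -, hδ⟩ := hN₀ (N₀ + 1 + 1) (by omega)
  obtain ⟨Ψ, hΨ⟩ :=
    exists_lt_uvTail K θ (1 / 8) (ρ₀ / 2) hθ ⟨by norm_num, by norm_num⟩ (by positivity) (N₀ + 1)
  have h1 := hδ Ψ (by rw [groundStateEnergy_top (by omega), top_add]; exact le_top)
  push_cast at h1 hΨ
  exact absurd h1 (not_le.2 hΨ)

/-! ### (a′) Small density is load-bearing only through jamming: the hard core at high density -/

/-- The unit hard core: `v(r) = ⊤` for `r ≤ 1` and `v(r) = 0` for `r > 1` (finite range `R₀ = 1`). -/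
def hardCore : ℝ → ℝ≥0∞ := (Set.Iic 1).indicator ⊤

/-- Inside the core the potential is `⊤`. -/
theorem hardCore_of_le_one {r : ℝ} (hr : r ≤ 1) : hardCore r = ⊤ := by
  simp [hardCore, Set.indicator_of_mem (Set.mem_Iic.2 hr)]

/-- The unit hard core is an admissible (measurable, finite-range) repulsive pair potential. -/
theorem isRepulsiveFiniteRange_hardCore : IsRepulsiveFiniteRange hardCore :=
  ⟨measurable_const.indicator measurableSet_Iic, 1, fun r hr =>
    Set.indicator_of_notMem (by simpa using hr) _⟩

/-- `L³ = N/ρ`. -/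
theorem sideLength_pow_three' {ρ : ℝ} (hρ : 0 < ρ) (N : ℕ) : sideLength ρ N ^ 3 = N / ρ := by
  unfold sideLength
  rw [← Real.rpow_natCast, ← Real.rpow_mul (by positivity)]
  norm_num

/-- Two non-negative reals with the same half-integer cell are within `1/2`. -/
theorem abs_sub_lt_half {a b : ℝ} (ha : 0 ≤ a) (hb : 0 ≤ b) (h : ⌊2 * a⌋₊ = ⌊2 * b⌋₊) :
    |a - b| < 1 / 2 := by
  have h1 : 2 * a < ⌊2 * a⌋₊ + 1 := Nat.lt_floor_add_one _
  have h2 : 2 * b < ⌊2 * b⌋₊ + 1 := Nat.lt_floor_add_one _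
  have h3 : (⌊2 * a⌋₊ : ℝ) ≤ 2 * a := Nat.floor_le (by linarith)
  have h4 : (⌊2 * b⌋₊ : ℝ) ≤ 2 * b := Nat.floor_le (by linarith)
  rw [h] at h1 h3
  rw [abs_sub_lt_iff]
  constructor <;> linarith

/-- PIGEONHOLE JAMMING: if `(⌊2L⌋₊ + 1)³ < N`, every configuration of `N` points of the box `Λ_L` has two
points at distance `< 1` (cells of side `1/2` have diameter `√3/2 < 1`). -/
theorem exists_dist_lt_one {N : ℕ} {L : ℝ} (hN : (⌊2 * L⌋₊ + 1) ^ 3 < N) {X : Config N}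
    (hX : X ∈ boxN N L) : ∃ i j : Fin N, i < j ∧ dist (X i) (X j) < 1 := by
  have hcell : ∀ (i : Fin N) (k : Fin 3), ⌊2 * X i k⌋₊ < ⌊2 * L⌋₊ + 1 := by
    intro i k
    have hk := (hX i k).2
    have : ⌊2 * X i k⌋₊ ≤ ⌊2 * L⌋₊ := Nat.floor_le_floor (by linarith)
    omega
  let f : Fin N → Fin 3 → Fin (⌊2 * L⌋₊ + 1) := fun i k => ⟨⌊2 * X i k⌋₊, hcell i k⟩
  have hcard : Fintype.card (Fin 3 → Fin (⌊2 * L⌋₊ + 1)) < Fintype.card (Fin N) := by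
    simpa [Fintype.card_fun, Fintype.card_fin] using hN
  obtain ⟨i, j, hne, hij⟩ := Fintype.exists_ne_map_eq_of_card_lt f hcard
  have hclose : dist (X i) (X j) < 1 := by
    have hk : ∀ k : Fin 3, dist (X i k) (X j k) ^ 2 < 1 / 4 := by
      intro k
      have h1 : ⌊2 * X i k⌋₊ = ⌊2 * X j k⌋₊ := by
        have := congr_fun hij k
        simpa [f] using congrArg Fin.val this
      have h2 := abs_sub_lt_half (hX i k).1.le (hX j k).1.le h1
      rw [Real.dist_eq]
      have h3 : 0 ≤ |X i k - X j k| := abs_nonneg _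
      nlinarith
    rw [EuclideanSpace.dist_eq, Real.sqrt_lt' one_pos, Fin.sum_univ_three, one_pow]
    linarith [hk 0, hk 1, hk 2]
  rcases lt_or_gt_of_ne hne with h | h
  · exact ⟨i, j, h, hclose⟩
  · exact ⟨j, i, h, by rwa [dist_comm]⟩

/-- In a jammed box the hard-core interaction is `⊤` at every configuration of the box. -/
theorem interaction_hardCore_eq_top {N : ℕ} {L : ℝ} (hN : (⌊2 * L⌋₊ + 1) ^ 3 < N) {X : Config N}
    (hX : X ∈ boxN N L) : interaction hardCore X = ⊤ := by
  obtain ⟨i, j, hij, hd⟩ := exists_dist_lt_one hN hX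
  unfold interaction
  refine eq_top_iff.2 ?_
  calc (⊤ : ℝ≥0∞) = hardCore (dist (X i) (X j)) := (hardCore_of_le_one hd.le).symm
    _ ≤ ∑ j' : Fin N with i < j', hardCore (dist (X i) (X j')) :=
        Finset.single_le_sum (f := fun j' => hardCore (dist (X i) (X j'))) (fun _ _ => zero_le)
          (Finset.mem_filter.2 ⟨Finset.mem_univ _, hij⟩)
    _ ≤ ∑ i' : Fin N, ∑ j' : Fin N with i' < j', hardCore (dist (X i') (X j')) :=
        Finset.single_le_sum (f := fun i' => ∑ j' : Fin N with i' < j', hardCore (dist (X i') (X j')))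
          (fun _ _ => zero_le) (Finset.mem_univ i)

/-- … hence every Dirichlet trial state of a jammed box has infinite energy … -/
theorem energy_hardCore_eq_top {N : ℕ} {L : ℝ} (hN : (⌊2 * L⌋₊ + 1) ^ 3 < N) (Ψ : TrialState N L) :
    energy hardCore Ψ = ⊤ := by
  unfold energy
  have hpt : ∀ X, interaction hardCore X * (‖Ψ.ψ X‖₊ : ℝ≥0∞) ^ 2 = ⊤ * (‖Ψ.ψ X‖₊ : ℝ≥0∞) ^ 2 := by
    intro X
    by_cases hX : X ∈ boxN N L
    · rw [interaction_hardCore_eq_top hN hX]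
    · simp [Ψ.eq_zero X hX]
  simp_rw [hpt]
  refine eq_top_iff.2 ?_
  have hmeas : Measurable fun X => (‖Ψ.ψ X‖₊ : ℝ≥0∞) ^ 2 :=
    (Ψ.contDiff.continuous.measurable.nnnorm.coe_nnreal_ennreal).pow_const 2
  calc (⊤ : ℝ≥0∞) = ⊤ * ∫⁻ X, (‖Ψ.ψ X‖₊ : ℝ≥0∞) ^ 2 := by rw [Ψ.norm_eq, mul_one]
    _ = ∫⁻ X, ⊤ * (‖Ψ.ψ X‖₊ : ℝ≥0∞) ^ 2 := (lintegral_const_mul ⊤ hmeas).symm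
    _ ≤ ∫⁻ X, kineticDensity Ψ.ψ X + ⊤ * (‖Ψ.ψ X‖₊ : ℝ≥0∞) ^ 2 := lintegral_mono fun X => le_add_self

/-- … and the ground-state energy of a jammed box is `⊤`. -/
theorem groundStateEnergy_hardCore_eq_top {N : ℕ} {L : ℝ} (hN : (⌊2 * L⌋₊ + 1) ^ 3 < N) :
    groundStateEnergy hardCore N L = ⊤ := by
  unfold groundStateEnergy
  exact iInf_eq_top.2 fun Ψ => energy_hardCore_eq_top hN Ψ

/-- At density `ρ = 1000` (core radius `1`) the box `Λ_{L_N}`, `L_N = (N/1000)^{1/3}`, is jammed for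
every `N ≥ 1000`: `(⌊2L⌋₊ + 1)³ ≤ (3L)³ = 27N/1000 < N`. -/
theorem jammed {N : ℕ} (hN : 1000 ≤ N) : (⌊2 * sideLength 1000 N⌋₊ + 1) ^ 3 < N := by
  set L := sideLength 1000 N with hL
  have hL3 : L ^ 3 = N / 1000 := sideLength_pow_three' (by norm_num) N
  have hN' : (1000 : ℝ) ≤ N := by exact_mod_cast hN
  have hL0 : 0 ≤ L := Real.rpow_nonneg (div_nonneg (Nat.cast_nonneg _) (by norm_num)) _
  have hL1 : 1 ≤ L := by
    by_contra hlt
    have hlt : L < 1 := not_le.mp hlt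
    have h1 : L ^ 3 < 1 := pow_lt_one₀ hL0 hlt three_ne_zero
    rw [hL3, div_lt_one (by norm_num)] at h1
    linarith
  have key : ((⌊2 * L⌋₊ + 1 : ℕ) : ℝ) ^ 3 < (N : ℝ) := by
    have hfl : (⌊2 * L⌋₊ : ℝ) ≤ 2 * L := Nat.floor_le (by linarith)
    calc ((⌊2 * L⌋₊ + 1 : ℕ) : ℝ) ^ 3 ≤ (3 * L) ^ 3 := by
            push_cast
            gcongr
            linarith
      _ = 27 * ((N : ℝ) / 1000) := by rw [mul_pow, hL3]; norm_num
      _ < (N : ℝ) := by linarith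
  exact_mod_cast key

/-- `BecUvTail` with the SMALL-DENSITY restriction removed (`∀ ρ > 0` instead of `∃ ρ₀, ∀ ρ < ρ₀`);
everything else verbatim. -/
def BecUvTailAllDensities : Prop :=
  ∀ v : ℝ → ℝ≥0∞, IsRepulsiveFiniteRange v → ∃ K : ℝ, 0 < K ∧ ∃ θ : ℝ, θ < 1 ∧
    ∀ ε : ℝ, 0 < ε → ε < 1 / 4 → ∀ ρ : ℝ, 0 < ρ →
      ∀ᶠ N : ℕ in atTop, ∃ δ : ℝ≥0∞, 0 < δ ∧ ∀ Ψ : TrialState N (sideLength ρ N),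
        energy v Ψ ≤ groundStateEnergy v N (sideLength ρ N) + δ →
          uvTail K ρ ε N Ψ.ψ ≤ ENNReal.ofReal (θ * N)

/-- **"Small `ρ`" is load-bearing — but only through JAMMING (`E₀ = ⊤`).** For the unit hard core
(`IsRepulsiveFiniteRange`, radius `1`) at density `ρ = 1000`, pigeonhole (`N` points of `Λ_L` in
`(⌊2L⌋₊+1)³ < N` cells of diameter `√3/2 < 1`, `jammed` for `N ≥ 1000`) makes `interaction = ⊤` on
`Λ_L^N`, so `energy = ⊤` for every Dirichlet trial state (`energy_hardCore_eq_top`), `E₀ = ⊤`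
(`groundStateEnergy_hardCore_eq_top`), the near-minimiser hypothesis is idle, and `exists_lt_uvTail`
bites.  For FINITE `v` (or `a(v) < ∞` and `ρ a³` small) nothing of the kind happens: the IBP bound of the
module docstring is uniform in `ρ`. -/
theorem becUvTail_false_allDensities : ¬ BecUvTailAllDensities := by
  intro h
  obtain ⟨K, -, θ, hθ, h⟩ := h hardCore isRepulsiveFiniteRange_hardCore
  obtain ⟨N₀, hN₀⟩ :=
    eventually_atTop.1 (h (1 / 8) (by norm_num) (by norm_num) 1000 (by norm_num))
  obtain ⟨δ, -, hδ⟩ := hN₀ (max N₀ 1000 + 1) ((le_max_left _ _).trans (Nat.le_succ _))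
  obtain ⟨Ψ, hΨ⟩ :=
    exists_lt_uvTail K θ (1 / 8) 1000 hθ ⟨by norm_num, by norm_num⟩ (by norm_num) (max N₀ 1000)
  have hjam : (⌊2 * sideLength 1000 (max N₀ 1000 + 1)⌋₊ + 1) ^ 3 < max N₀ 1000 + 1 :=
    jammed ((le_max_right _ _).trans (Nat.le_succ _))
  have h1 := hδ Ψ (by rw [groundStateEnergy_hardCore_eq_top hjam, top_add]; exact le_top)
  push_cast at h1 hΨ
  exact absurd h1 (not_le.2 hΨ)

/-! ### NEAR-MISSES (in progress this cycle; `sorry` is permitted ONLY in this work file) -/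

/-- The line's second stub `stub_uvTailOfKineticBudget` with the threshold `K` chosen BEFORE the kinetic
constant `C` (`∃ K ∀ C` instead of `∀ C ∃ K`); otherwise verbatim. -/
def UvTailOfKineticBudgetUniformK : Prop :=
  ∃ K : ℝ, 0 < K ∧ ∀ C : ℝ, 0 < C → ∃ θ : ℝ, θ < 1 ∧ ∀ ε : ℝ, 0 < ε → ε < 1 / 4 → ∀ ρ : ℝ, 0 < ρ →
    ∀ᶠ N : ℕ in atTop, ∀ Ψ : TrialState N (sideLength ρ N),
      (∫⁻ X, kineticDensity Ψ.ψ X) ≤ ENNReal.ofReal (C * ρ * N) →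
        uvTail K ρ ε N Ψ.ψ ≤ ENNReal.ofReal (θ * N)

/-- NEAR-MISS (B, tightness of the line): NO threshold `K` serves all kinetic constants `C` — the §1
witness with `k⋆ = (⌊K√ρL⌋+1,0,0)` has `T/N = (2πm/L')² + 3κ_τ/(P₂L'²) → (2πK)²ρ/(1−2ε)²`, so for
`C > (2πK/(1−2ε))²` it meets `T ≤ CρN` eventually while `uvTail > θN`; hence in the stub necessarily
`K(C) ≥ (1−2ε)√C/(2π)` (the IBP proof gives `K(C) ≲ √C`: same order).  Obstruction: the kinetic
energy of the complex-modulated product orbital (`HasFDerivAt` of `o·e^{ip·x}`, `|∇u|² =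
A²(p²o² + |∇o|²)`, `∫` via `ProductOrbital.integral_orbD_sq`) is not yet formalised. -/
theorem not_uvTailOfKineticBudgetUniformK : ¬ UvTailOfKineticBudgetUniformK := by
  sorry

end Summit.AtomisticToContinuum.BoseEinsteinCondensation.Cruxes.BecUvTail.Disproof

end
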